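import Summits.Ventures.PercRepro.GZ24Lemma12

/-!
# Gladkov's Theorem 1.3 (formerly Gladkov–Zimin Conjecture 6.2)

For every `ε > 0` there is `δ > 0` such that, for every finite multigraph, every edge weights
and every marks `a, b, c`: if `P(ab|c) < δ` and `P(ac|b) < δ` then `P(abc) < ε` or
`P(a|b|c) < ε` (Gladkov, arXiv:2408.08457, Theorem 1.3; `δ = ε³/8` works).
Proof (§7.2 of the paper): Lemma 1.2 for the triple `(b, a, c)` reads
`B²/(B + P3) + B²/(B + P1) ≤ B + (B + P2)²`; with `B + P3 ≤ 1 − T`, `P1, P2 < δ` this gives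
`T·B² ≤ 4δ`, impossible when `T, B ≥ ε` and `4δ < ε³`.
-/

namespace PercRepro

open Finset

/-- The five rows sum to `1`. -/
theorem law3_sum_eq_one {V E : Type*} [Fintype E] [DecidableEq E] (G : MultiGraph V E)
    (p : E → ℝ) (a b c : V) :
    G.law3 p a b c 0 + G.law3 p a b c 1 + G.law3 p a b c 2 + G.law3 p a b c 3 +
      G.law3 p a b c 4 = 1 := by
  have h1 := law3_zero_add_one_add_two G p a b c
  have h2 := law3_four_add_three G p a b c
  have hc : G.connEvent a b ∪ G.connEvent a c = (G.sepEvent a b ∩ G.sepEvent a c)ᶜ := by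
    ext ω
    simp only [Set.mem_union, Set.mem_compl_iff, Set.mem_inter_iff, MultiGraph.mem_connEvent,
      MultiGraph.mem_sepEvent]
    tauto
  rw [hc, prob_compl] at h1
  linarith

/-- Lemma 1.2 for the triple `(b, a, c)` in the rows of `(a, b, c)`:
`B²/(B + P3) + B²/(B + P1) ≤ B + (B + P2)²`. -/
theorem lemma12_swapped {V E : Type*} [Fintype E] [DecidableEq E] (G : MultiGraph V E)
    {p : E → ℝ} (hp : IsProb p) (a b c : V) :
    G.law3 p a b c 4 ^ 2 / (G.law3 p a b c 4 + G.law3 p a b c 3) +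
      G.law3 p a b c 4 ^ 2 / (G.law3 p a b c 4 + G.law3 p a b c 1) ≤
      G.law3 p a b c 4 + (G.law3 p a b c 4 + G.law3 p a b c 2) ^ 2 := by
  classical
  have h := G.gladkov_lemma12_events hp b a c
  have e0 : G.isoEvent b a c = G.sepEvent a b ∩ G.sepEvent a c ∩ G.sepEvent b c := by
    ext ω
    simp only [MultiGraph.isoEvent, Set.mem_inter_iff, MultiGraph.mem_sepEvent,
      G.conn_comm (u := b) (v := a)]
    tauto
  have e1 : G.sepEvent b c ∩ G.sepEvent a c = G.sepEvent a c ∩ G.sepEvent b c := Set.inter_comm _ _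
  have e2 : G.sepEvent b a ∩ G.sepEvent a c = G.sepEvent a b ∩ G.sepEvent a c := by
    ext ω
    simp only [Set.mem_inter_iff, MultiGraph.mem_sepEvent, G.conn_comm (u := b) (v := a)]
  have e3 : G.sepEvent b a ∩ G.sepEvent b c = G.sepEvent a b ∩ G.sepEvent b c := by
    ext ω
    simp only [Set.mem_inter_iff, MultiGraph.mem_sepEvent, G.conn_comm (u := b) (v := a)]
  rw [e0, e1, e2, e3] at h
  rw [law3_four_add_three, law3_four_add_one, law3_four_add_two, MultiGraph.law3_four,
    G.partitionEvent_row_a_b_c, add_comm]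
  exact h

/-- **Gladkov's Theorem 1.3**: for every `ε > 0` there is `δ > 0` (here `ε³/8`) such that
`P(ab|c) < δ` and `P(ac|b) < δ` force `P(abc) < ε` or `P(a|b|c) < ε`. -/
theorem gladkov_thm13 {ε : ℝ} (hε : 0 < ε) :
    ∃ δ > 0, ∀ {V E : Type} [Fintype E] [DecidableEq E] (G : MultiGraph V E) (p : E → ℝ),
      IsProb p → ∀ a b c : V, G.law3 p a b c 1 < δ → G.law3 p a b c 2 < δ →
        G.law3 p a b c 0 < ε ∨ G.law3 p a b c 4 < ε := by
  refine ⟨ε ^ 3 / 8, by positivity, ?_⟩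
  intro V E _ _ G p hp a b c h1 h2
  generalize hδ : ε ^ 3 / 8 = δ at h1 h2
  by_contra hcon
  have hT : ε ≤ G.law3 p a b c 0 := not_lt.mp fun h => hcon (Or.inl h)
  have hB : ε ≤ G.law3 p a b c 4 := not_lt.mp fun h => hcon (Or.inr h)
  set T := G.law3 p a b c 0 with hTdef
  set P1 := G.law3 p a b c 1 with hP1def
  set P2 := G.law3 p a b c 2 with hP2def
  set P3 := G.law3 p a b c 3 with hP3def
  set B := G.law3 p a b c 4 with hBdef
  have hsum : T + P1 + P2 + P3 + B = 1 := law3_sum_eq_one G p a b c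
  have hnn : 0 ≤ T ∧ 0 ≤ P1 ∧ 0 ≤ P2 ∧ 0 ≤ P3 ∧ 0 ≤ B :=
    ⟨prob_nonneg hp _, prob_nonneg hp _, prob_nonneg hp _, prob_nonneg hp _, prob_nonneg hp _⟩
  obtain ⟨hT0, hP10, hP20, hP30, hB0⟩ := hnn
  have hL := lemma12_swapped G hp a b c
  -- `ε ≤ 1` (else `T < ε` trivially)
  have hε1 : ε ≤ 1 := by linarith
  have hδ0 : 0 < δ := by rw [← hδ]; positivity
  have hδ1 : δ ≤ 1 := by
    have : ε ^ 3 ≤ 1 := pow_le_one₀ hε.le hε1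
    rw [← hδ]; linarith
  have hBpos : 0 < B := lt_of_lt_of_le hε hB
  -- the two denominators
  have hD1 : B + P3 ≤ 1 - T := by linarith
  have hD2 : B + P1 ≤ B + δ := by linarith
  have hlow1 : B ^ 2 / (1 - T) ≤ B ^ 2 / (B + P3) :=
    div_le_div_of_nonneg_left (sq_nonneg B) (by linarith) hD1
  have hlow2 : B ^ 2 / (B + δ) ≤ B ^ 2 / (B + P1) :=
    div_le_div_of_nonneg_left (sq_nonneg B) (by linarith) hD2
  have hR : B + (B + P2) ^ 2 ≤ B + (B + δ) ^ 2 := by nlinarith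
  have hmain : B ^ 2 / (1 - T) + B ^ 2 / (B + δ) ≤ B + (B + δ) ^ 2 := by linarith
  -- clear the denominators
  have h1T : 0 < 1 - T := by linarith
  have hBδ : 0 < B + δ := by linarith
  have hq : B ^ 2 / (B + δ) = B - B * δ / (B + δ) := by
    field_simp
    ring
  have hfrac : B * δ / (B + δ) ≤ δ := by
    rw [div_le_iff₀ hBδ]; nlinarith
  have hkey : B ^ 2 / (1 - T) ≤ δ + (B + δ) ^ 2 := by
    rw [hq] at hmain; linarith
  rw [div_le_iff₀ h1T] at hkey
  -- `T B² ≤ 4 δ`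
  have hB1 : B ≤ 1 := by linarith
  have hbr : 0 ≤ δ + 2 * B * δ + δ ^ 2 := by positivity
  have h1T1 : 1 - T ≤ 1 := by linarith
  have hstep : T * B ^ 2 ≤ (1 - T) * (δ + 2 * B * δ + δ ^ 2) := by nlinarith [hkey]
  have hstep2 : (1 - T) * (δ + 2 * B * δ + δ ^ 2) ≤ δ + 2 * B * δ + δ ^ 2 :=
    mul_le_of_le_one_left hbr h1T1
  have hBδ2 : 2 * B * δ ≤ 2 * δ := mul_le_mul_of_nonneg_right (by linarith) hδ0.le
  have hδδ : δ ^ 2 ≤ δ := by rw [sq]; exact mul_le_of_le_one_left hδ0.le hδ1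
  have hTB : T * B ^ 2 ≤ 4 * δ := by linarith
  have hε3 : ε ^ 3 ≤ T * B ^ 2 := by
    have h2 : ε ^ 2 ≤ B ^ 2 := pow_le_pow_left₀ hε.le hB 2
    calc ε ^ 3 = ε * ε ^ 2 := by ring
      _ ≤ T * B ^ 2 := mul_le_mul hT h2 (by positivity) hT0
  rw [← hδ] at hTB
  linarith

end PercRepro
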